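import Literature.NumberTheory.Automorphic.CasimirBlockTorusWeightBound          -- ★ p830261 (A-p06 (g24), «hq»): `u21_ninth_mul_one_add_label_sq_le_one_add_upqKBlockScalar`
import Literature.NumberTheory.Automorphic.HilbertRepIrreducibleBlockSubmodules   -- ★ p830183 (LEAD F0P3b-p01 (g2), G3): `ClosedSubrep.eq_bot_or_eq_of_le_of_isTopIrreducible`
import HarnessLib

/-!
# «hq» in the LEAD's block currency: `∃ δ > 0, ∀ W ∈ S, δ · (1 + a² + b² + c²) ≤ 1 + q_W` for `U(2,1)`, from the H4b highest-weight vectors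

Topic `NumberTheory/Automorphic`; namespace `Literature.NumberTheory.Automorphic`; THEOREMS ONLY (no `def`, no named fact, no instance, no notation,
no `sorry`).  Cell `hodgecm-mathlib`, F0∕P3, T1a arch line, road HC for the letter A5 ★ `UnitaryGroup.ArchIntegratedOperatorTraceClass` ([Knapp1986,
Thm. 10.2]; [Varadarajan1989, §5.4 Lemma 21, Thm. 22]).  The LEAD's composition ★-to-be `summable_finrank_mul_inv_pow_casimir_of_label` (F0P3b-p01 (g2)
2026-08-31T17:54:49Z, p830326) takes four inputs on a family `S` of pairwise-orthogonal, topologically irreducible, finite-dimensional `K`-blocks `W ≤ H_K^∞` of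
a unitary `ϖ` of `U(2,1)` with a label `w : S → ℤ × ℤ × ℤ`: (D2) `finrank W ≤ C (1 + |a|)`, (D4′) equal labels ⇒ equivalent blocks, and
**(hq)** `∃ δ > 0, ∀ W : S, δ · (1 + a² + b² + c²) ≤ 1 + upqKBlockScalar ϖ W`.  This file delivers (hq) from the one H4b output it depends on — (D3) «the highest
weight OCCURS»: each block `W` of label `(a, b, c)` contains a non-zero vector `v` on which the diagonal torus `diag(u₀, u₁ | u′₀) ∈ U(2) × U(1)` acts by
`u₀^{a+b} u₁^{b} u′₀^{c}` (A-p03 (g21) 2026-08-31T17:29:06Z export convention, in the `kV ∘ diagHom` frame of ★ `exp_smul_torusGen`) — with `δ = 1/9`: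
★ `u21_ninth_mul_one_add_label_sq_le_one_add_upqKBlockScalar` (p830261: Cauchy–Schwarz in `𝔨`, one-parameter eigenvectors, H3a's ★ `upqKBlockScalar`) applied
block by block, the three hypotheses of H3a (`W ≤ H^∞`, `K`-stable, `K`-irreducible as a submodule) being supplied by `W ≤ H_K^∞`, ★ `ClosedSubrep.apply_mem` and
★ G3 `ClosedSubrep.eq_bot_or_eq_of_le_of_isTopIrreducible` (p830183).

THE LEAN TEXT: `u21_kBlock_hq_of_highestWeight` (pointwise form `∀ W : S, 9⁻¹ · (1 + a² + b² + c²) ≤ 1 + q_W`, label `w : S → ℕ × ℤ × ℤ`) and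
`u21_kBlock_exists_delta_of_highestWeight` (the contract's `∃ δ > 0, …` with the label coerced to `ℤ × ℤ × ℤ` exactly as ★-to-be p830326 consumes it).
HONEST LABEL: closes no registered stub by itself; (D2), (D3), (D4′) are A-p03's H4b (in flight).  HC_CM is proved only modulo the 2 remaining named inputs
(hLiu418, h413) — behind them the booked printed statements + the MOD package — until rung 0 closes.

## References
* V. S. Varadarajan, *An Introduction to Harmonic Analysis on Semisimple Lie Groups* (1989), §5.4, Lemma 21, Thm. 22 [Varadarajan1989].
* A. W. Knapp, *Representation Theory of Semisimple Groups: An Overview Based on Examples* (1986), Thm. 10.2 (proof) [Knapp1986].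
-/

set_option autoImplicit false

noncomputable section

namespace Literature.NumberTheory.Automorphic

open Literature.RepresentationTheory.KonnoKonno2007 Literature.RepresentationTheory.KonnoKonno2007.RealDualPair

variable {E : Type*} [NormedAddCommGroup E] [InnerProductSpace ℂ E] [CompleteSpace E]
  (ϖ : ContRepresentation ℂ (uFormGroup (Fin 2) (Fin 1)).carrier E)

/-- **(hq) POINTWISE, from the highest-weight vectors**: for every block `W ∈ S` (topologically irreducible, finite-dimensional, `W ≤ H_K^∞`) of label
`w W = (a, b, c)` carrying a non-zero torus weight vector of weight `(a+b, b | c)`, `9⁻¹ · (1 + a² + b² + c²) ≤ 1 + upqKBlockScalar ϖ W`.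
[cite: Varadarajan1989, §5.4 Lemma 21] [cite: Knapp1986, Thm. 10.2 (proof)] -/
theorem u21_kBlock_hq_of_highestWeight (hu : ϖ.IsUnitary) (hc : ϖ.IsStronglyContinuous)
    {S : Set (ContRepresentation.ClosedSubrep (ϖ.restrict (Subgroup.inclusion (uFormGroup (Fin 2) (Fin 1)).maximalCompact_le_carrier)))}
    (hirr : ∀ W ∈ S, W.toContRep.IsTopIrreducible) (hfd : ∀ W ∈ S, FiniteDimensional ℂ W.toSubmodule)
    (hsm : ∀ W ∈ S, W.toSubmodule ≤ harishChandraSpace (uFormGroup (Fin 2) (Fin 1)) ϖ)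
    (w : S → ℕ × ℤ × ℤ)
    (hD3 : ∀ W : S, ∃ v ∈ (W : ContRepresentation.ClosedSubrep
        (ϖ.restrict (Subgroup.inclusion (uFormGroup (Fin 2) (Fin 1)).maximalCompact_le_carrier))).toSubmodule, v ≠ 0 ∧
        ∀ (u : Fin 2 → Circle) (u' : Fin 1 → Circle),
          ϖ (RealDualPair.UForm.kV (Fin 2) (Fin 1)
              (Literature.Analysis.SegalBargmann.diagHom u, Literature.Analysis.SegalBargmann.diagHom u')) v =
            (((u 0 : Circle) : ℂ) ^ (((w W).1 : ℤ) + (w W).2.1) * ((u 1 : Circle) : ℂ) ^ (w W).2.1 *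
              ((u' 0 : Circle) : ℂ) ^ (w W).2.2) • v) (W : S) :
    (9 : ℝ)⁻¹ * (1 + (((w W).1 : ℝ) ^ 2 + ((w W).2.1 : ℝ) ^ 2 + ((w W).2.2 : ℝ) ^ 2)) ≤
      1 + upqKBlockScalar ϖ (W : ContRepresentation.ClosedSubrep
        (ϖ.restrict (Subgroup.inclusion (uFormGroup (Fin 2) (Fin 1)).maximalCompact_le_carrier))).toSubmodule := by
  set W₀ : ContRepresentation.ClosedSubrep (ϖ.restrict (Subgroup.inclusion (uFormGroup (Fin 2) (Fin 1)).maximalCompact_le_carrier)) :=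
    (W : ContRepresentation.ClosedSubrep (ϖ.restrict (Subgroup.inclusion (uFormGroup (Fin 2) (Fin 1)).maximalCompact_le_carrier))) with hW₀
  haveI : FiniteDimensional ℂ W₀.toSubmodule := hfd W₀ W.2
  obtain ⟨v, hv, hv0, hwt⟩ := hD3 W
  -- H3a's three hypotheses on the block
  have hWs : W₀.toSubmodule ≤ smoothVectors (uFormGroup (Fin 2) (Fin 1)) ϖ := fun x hx => (hsm W₀ W.2 hx).1
  have hWK : ∀ (k : (uFormGroup (Fin 2) (Fin 1)).maximalCompact) (x : E), x ∈ W₀.toSubmodule →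
      ϖ (Subgroup.inclusion (uFormGroup (Fin 2) (Fin 1)).maximalCompact_le_carrier k) x ∈ W₀.toSubmodule := fun k x hx =>
    W₀.apply_mem k hx
  have hWirr : ∀ W' : Submodule ℂ E, W' ≤ W₀.toSubmodule →
      (∀ (k : (uFormGroup (Fin 2) (Fin 1)).maximalCompact) (x : E), x ∈ W' →
        ϖ (Subgroup.inclusion (uFormGroup (Fin 2) (Fin 1)).maximalCompact_le_carrier k) x ∈ W') → W' = ⊥ ∨ W' = W₀.toSubmodule :=
    fun W' hle hst => ClosedSubrep.eq_bot_or_eq_of_le_of_isTopIrreducible W₀ (hirr W₀ W.2) W' hle hst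
  -- the integral weight `(m, n) = ((a+b, b), c)`
  set m : Fin 2 → ℤ := ![((w W).1 : ℤ) + (w W).2.1, (w W).2.1] with hm
  set n : Fin 1 → ℤ := ![(w W).2.2] with hn
  have hw' : ∀ (z : Fin 2 → Circle) (z' : Fin 1 → Circle),
      ϖ (RealDualPair.UForm.kV (Fin 2) (Fin 1)
          (Literature.Analysis.SegalBargmann.diagHom z, Literature.Analysis.SegalBargmann.diagHom z')) v =
        ((∏ l, ((z l : Circle) : ℂ) ^ (m l)) * ∏ l, ((z' l : Circle) : ℂ) ^ (n l)) • v := by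
    intro z z'
    rw [hwt z z', Fin.prod_univ_two, Fin.prod_univ_one]
    simp only [hm, hn, Matrix.cons_val_zero, Matrix.cons_val_one]
  have h := u21_ninth_mul_one_add_label_sq_le_one_add_upqKBlockScalar ϖ W₀.toSubmodule hu hc hWs hWK hWirr hv hv0 m n hw'
  have h0 : m 0 - m 1 = ((w W).1 : ℤ) := by simp [hm]
  have h1 : m 1 = (w W).2.1 := by simp [hm]
  have h2 : n 0 = (w W).2.2 := by simp [hn]
  rw [h0, h1, h2] at h
  simpa only [Int.cast_natCast] using h

/-- **(hq) IN THE CONTRACT'S SHAPE** (★-to-be `summable_finrank_mul_inv_pow_casimir_of_label`, F0P3b-p01 (g2) p830326): with the label coerced to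
`ℤ × ℤ × ℤ`, `∃ δ > 0, ∀ W : S, δ · (1 + a² + b² + c²) ≤ 1 + upqKBlockScalar ϖ W` — here `δ = 1/9`. [cite: Varadarajan1989, §5.4 Lemma 21]
[cite: Knapp1986, Thm. 10.2 (proof)] -/
theorem u21_kBlock_exists_delta_of_highestWeight (hu : ϖ.IsUnitary) (hc : ϖ.IsStronglyContinuous)
    {S : Set (ContRepresentation.ClosedSubrep (ϖ.restrict (Subgroup.inclusion (uFormGroup (Fin 2) (Fin 1)).maximalCompact_le_carrier)))}
    (hirr : ∀ W ∈ S, W.toContRep.IsTopIrreducible) (hfd : ∀ W ∈ S, FiniteDimensional ℂ W.toSubmodule)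
    (hsm : ∀ W ∈ S, W.toSubmodule ≤ harishChandraSpace (uFormGroup (Fin 2) (Fin 1)) ϖ)
    (w : S → ℕ × ℤ × ℤ)
    (hD3 : ∀ W : S, ∃ v ∈ (W : ContRepresentation.ClosedSubrep
        (ϖ.restrict (Subgroup.inclusion (uFormGroup (Fin 2) (Fin 1)).maximalCompact_le_carrier))).toSubmodule, v ≠ 0 ∧
        ∀ (u : Fin 2 → Circle) (u' : Fin 1 → Circle),
          ϖ (RealDualPair.UForm.kV (Fin 2) (Fin 1)
              (Literature.Analysis.SegalBargmann.diagHom u, Literature.Analysis.SegalBargmann.diagHom u')) v =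
            (((u 0 : Circle) : ℂ) ^ (((w W).1 : ℤ) + (w W).2.1) * ((u 1 : Circle) : ℂ) ^ (w W).2.1 *
              ((u' 0 : Circle) : ℂ) ^ (w W).2.2) • v) :
    ∃ δ : ℝ, 0 < δ ∧ ∀ W : S,
      δ * (1 + (((((w W).1 : ℤ), (w W).2).1 : ℝ) ^ 2 + ((((w W).1 : ℤ), (w W).2).2.1 : ℝ) ^ 2 +
        ((((w W).1 : ℤ), (w W).2).2.2 : ℝ) ^ 2)) ≤
        1 + upqKBlockScalar ϖ (W : ContRepresentation.ClosedSubrep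
          (ϖ.restrict (Subgroup.inclusion (uFormGroup (Fin 2) (Fin 1)).maximalCompact_le_carrier))).toSubmodule := by
  refine ⟨(9 : ℝ)⁻¹, by norm_num, fun W => ?_⟩
  have h := u21_kBlock_hq_of_highestWeight ϖ hu hc hirr hfd hsm w hD3 W
  simpa only [Int.cast_natCast] using h

end Literature.NumberTheory.Automorphic

end
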